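import Mathlib.Analysis.Calculus.LocalExtr.Polynomial
import Mathlib.Analysis.SpecialFunctions.Pow.Continuity
import Mathlib.Analysis.SpecialFunctions.Pow.Real
import Mathlib.Analysis.SpecialFunctions.Log.Deriv
import Mathlib.Analysis.SpecialFunctions.ExpDeriv
import HarnessLib

/-!
# Laguerre's lemma: `x f' + β f` has at least as many real zeros as `f` (`β > 0`)

Topic `Literature/Analysis/Complex`; support file for the discharge of the named fact
`Literature.Analysis.Complex.PolyaLaguerre_gaussian_CZDS` (`HutchinsonMultiplier.lean`), whose
proof (`HutchinsonMultiplierProofs.lean`) follows Laguerre's classical argument as presented by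
Pólya (1929) and Craven–Csordas (1995): the operator `f ↦ θf + βf`, `θ = x d/dx`, `β > 0`, does not
decrease the number of real zeros counted with multiplicity and preserves the degree, hence does
not increase `Z_c`; iterating it realises the multiplier sequence `((k + β)^N)_k`.

## Contents (all proved)

* `LaguerreCZDS.coeff_step`, `natDegree_step`, `step_ne_zero`: `θf + βf = Σ (k + β) b_k X^k`.
* `LaguerreCZDS.exists_root_step`: Rolle for `|x|^β f(x)` between consecutive zeros of the same
  sign (or `0`): a zero of `x f' + β f` strictly in between.
* `LaguerreCZDS.card_roots_le_step`: `card (roots f) ≤ card (roots (X f' + C β f))`.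
* `LaguerreCZDS.card_roots_le_iterate`, `coeff_iterate`, `natDegree_iterate`: the `N`-fold iterate.

## References

* G. Pólya, *Über einen Satz von Laguerre*, Jber. DMV 38 (1929) 161–168.
* T. Craven, G. Csordas, *Complex zero decreasing sequences*, Methods Appl. Anal. 2 (1995) 420–441.
* T. H. Nguyen, A. Vishnyakova, arXiv:1903.09070, p. 3 Thm. C [NguyenVishnyakova2019].
-/

noncomputable section

namespace Literature.Analysis.Complex.LaguerreCZDS

open Polynomial

/-- Coefficients of the Laguerre step: `(X f' + β f)_k = (k + β) f_k`. [folklore] -/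
theorem coeff_step (f : ℝ[X]) (β : ℝ) (k : ℕ) :
    (X * derivative f + C β * f).coeff k = ((k : ℝ) + β) * f.coeff k := by
  rw [coeff_add, coeff_C_mul]
  rcases k with _ | k
  · simp
  · rw [coeff_X_mul, coeff_derivative]
    push_cast
    ring

/-- The Laguerre step does not raise the degree. [folklore] -/
theorem natDegree_step_le (f : ℝ[X]) (β : ℝ) :
    (X * derivative f + C β * f).natDegree ≤ f.natDegree := by
  refine (natDegree_le_iff_coeff_eq_zero).2 fun k hk => ?_
  rw [coeff_step, coeff_eq_zero_of_natDegree_lt hk, mul_zero]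

/-- For `β > 0` and `f ≠ 0` the Laguerre step is nonzero. [folklore] -/
theorem step_ne_zero {f : ℝ[X]} (hf : f ≠ 0) {β : ℝ} (hβ : 0 < β) :
    X * derivative f + C β * f ≠ 0 := by
  intro h
  have h1 := congrArg (fun p : ℝ[X] => p.coeff f.natDegree) h
  simp only [coeff_step, coeff_zero] at h1
  exact mul_ne_zero (by positivity) (leadingCoeff_ne_zero.2 hf) h1

/-- For `β > 0` the Laguerre step preserves the degree. [folklore] -/
theorem natDegree_step (f : ℝ[X]) {β : ℝ} (hβ : 0 < β) :
    (X * derivative f + C β * f).natDegree = f.natDegree := by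
  by_cases hf : f = 0
  · simp [hf]
  refine le_antisymm (natDegree_step_le f β) (le_natDegree_of_ne_zero ?_)
  rw [coeff_step]
  exact mul_ne_zero (by positivity) (leadingCoeff_ne_zero.2 hf)

/-- Evaluation of the Laguerre step: `(X f' + β f)(x) = x f'(x) + β f(x)`. [folklore] -/
theorem eval_step (f : ℝ[X]) (β x : ℝ) :
    (X * derivative f + C β * f).eval x = x * f.derivative.eval x + β * f.eval x := by
  simp [eval_add, eval_mul, eval_X, eval_C]

/-- **Rolle step.** For `β > 0`, `x < y` on the same side of `0` (closed), with `|x|^β f(x) =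
|y|^β f(y) = 0`, the polynomial `X f' + β f` has a zero strictly between `x` and `y`
(Rolle for `u ↦ |u|^β f(u)`, whose derivative at `u ≠ 0` is `|u|^β u⁻¹ (u f'(u) + β f(u))`).
[folklore] -/
theorem exists_root_step (f : ℝ[X]) {β : ℝ} (hβ : 0 < β) {x y : ℝ} (hxy : x < y)
    (h0 : y ≤ 0 ∨ 0 ≤ x) (hx : x = 0 ∨ f.eval x = 0) (hy : y = 0 ∨ f.eval y = 0) :
    ∃ z ∈ Set.Ioo x y, (X * derivative f + C β * f).eval z = 0 := by
  set H : ℝ → ℝ := fun u => |u| ^ β * f.eval u with hH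
  have hcont : Continuous H :=
    ((Real.continuous_rpow_const hβ.le).comp continuous_abs).mul f.continuous
  have hH0 : ∀ u, (u = 0 ∨ f.eval u = 0) → H u = 0 := by
    rintro u (rfl | hu)
    · simp [hH, Real.zero_rpow hβ.ne']
    · simp [hH, hu]
  have hne : ∀ u ∈ Set.Ioo x y, u ≠ 0 := by
    rintro u ⟨hxu, huy⟩ rfl
    rcases h0 with h | h <;> linarith
  have hderiv : ∀ u ∈ Set.Ioo x y, HasDerivAt H
      (Real.exp (Real.log u * β) * (u⁻¹ * β) * f.eval u
        + Real.exp (Real.log u * β) * f.derivative.eval u) u := by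
    intro u hu
    have hu0 := hne u hu
    have h1 : HasDerivAt (fun v => Real.exp (Real.log v * β))
        (Real.exp (Real.log u * β) * (u⁻¹ * β)) u :=
      ((Real.hasDerivAt_log hu0).mul_const β).exp
    have h2 := h1.mul (f.hasDerivAt u)
    refine h2.congr_of_eventuallyEq ?_
    filter_upwards [eventually_ne_nhds hu0] with v hv
    simp only [hH]
    rw [Real.rpow_def_of_pos (abs_pos.2 hv), Real.log_abs]
    rfl
  obtain ⟨c, hc, hc0⟩ :=
    exists_hasDerivAt_eq_zero hxy hcont.continuousOn ((hH0 x hx).trans (hH0 y hy).symm) hderiv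
  refine ⟨c, hc, ?_⟩
  have hc0' : c ≠ 0 := hne c hc
  have hexp : 0 < Real.exp (Real.log c * β) := Real.exp_pos _
  have h3 : Real.exp (Real.log c * β) * (c⁻¹ * β * f.eval c + f.derivative.eval c) = 0 := by
    rw [← hc0]; ring
  have h4 : c⁻¹ * β * f.eval c + f.derivative.eval c = 0 := by
    rcases mul_eq_zero.1 h3 with h | h
    · exact absurd h hexp.ne'
    · exact h
  rw [eval_step]
  have h5 : c * (c⁻¹ * β * f.eval c + f.derivative.eval c) = 0 := by rw [h4, mul_zero]
  have h6 : c * (c⁻¹ * β * f.eval c + f.derivative.eval c)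
      = c * f.derivative.eval c + β * f.eval c := by
    field_simp
    ring
  rw [← h6]
  exact h5

/-- At a nonzero root the multiplicity drops by at most one under the Laguerre step. [folklore] -/
theorem rootMultiplicity_sub_one_le_step {f : ℝ[X]} (hf : f ≠ 0) {β : ℝ} (hβ : 0 < β) (t : ℝ) :
    f.rootMultiplicity t - 1 ≤ (X * derivative f + C β * f).rootMultiplicity t := by
  rw [le_rootMultiplicity_iff (step_ne_zero hf hβ)]
  have h1 : (X - C t) ^ (f.rootMultiplicity t - 1) ∣ derivative f := by
    by_cases hd : derivative f = 0
    · rw [hd]; exact dvd_zero _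
    exact (le_rootMultiplicity_iff hd).1
      (rootMultiplicity_sub_one_le_derivative_rootMultiplicity f t)
  have h2 : (X - C t) ^ (f.rootMultiplicity t - 1) ∣ f :=
    (pow_dvd_pow _ (Nat.sub_le _ _)).trans (pow_rootMultiplicity_dvd f t)
  exact dvd_add (dvd_mul_of_dvd_right h1 _) (dvd_mul_of_dvd_right h2 _)

/-- At `0` the multiplicity does not drop under the Laguerre step. [folklore] -/
theorem rootMultiplicity_zero_le_step {f : ℝ[X]} (hf : f ≠ 0) {β : ℝ} (hβ : 0 < β) :
    f.rootMultiplicity 0 ≤ (X * derivative f + C β * f).rootMultiplicity 0 := by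
  rw [le_rootMultiplicity_iff (step_ne_zero hf hβ)]
  simp only [map_zero, sub_zero]
  have h2 : X ^ f.rootMultiplicity 0 ∣ f := by
    simpa using pow_rootMultiplicity_dvd f 0
  have h1 : X ^ (f.rootMultiplicity 0 - 1) ∣ derivative f := by
    by_cases hd : derivative f = 0
    · rw [hd]; exact dvd_zero _
    simpa using (le_rootMultiplicity_iff hd).1
      (rootMultiplicity_sub_one_le_derivative_rootMultiplicity f 0)
  refine dvd_add ?_ (dvd_mul_of_dvd_right h2 _)
  rcases Nat.eq_zero_or_pos (f.rootMultiplicity 0) with hm | hm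
  · rw [hm, pow_zero]; exact one_dvd _
  · obtain ⟨q, hq⟩ := h1
    rw [hq, ← mul_assoc, ← pow_succ', Nat.sub_add_cancel hm]
    exact dvd_mul_right _ _

/-- **Laguerre's lemma (one step).** For `β > 0`, `X f' + β f` has at least as many real roots,
counted with multiplicity, as `f`.  Proof: Rolle for `|x|^β f` on the gaps between consecutive
elements of `{0} ∪ {real roots}` plus the surviving multiplicities. [folklore] -/
theorem card_roots_le_step (f : ℝ[X]) {β : ℝ} (hβ : 0 < β) :
    Multiset.card f.roots ≤ Multiset.card (X * derivative f + C β * f).roots := by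
  classical
  rcases eq_or_ne f 0 with rfl | hf
  · simp
  set g := X * derivative f + C β * f with hg_def
  have hg : g ≠ 0 := step_ne_zero hf hβ
  set R := f.roots.toFinset with hR
  set s := insert (0 : ℝ) R with hs
  set t := g.roots.toFinset with ht
  -- Rolle: consecutive elements of `s` are separated by a root of `g`
  have hinter : s.card ≤ (t \ s).card + 1 := by
    refine Finset.card_le_sdiff_of_interleaved fun x hx y hy hxy hxy' => ?_
    have h0 : y ≤ 0 ∨ 0 ≤ x := by
      by_contra hcon
      push Not at hcon
      exact hxy' 0 (Finset.mem_insert_self _ _) ⟨hcon.2, hcon.1⟩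
    have hmem : ∀ u ∈ s, u = 0 ∨ f.eval u = 0 := by
      intro u hu
      rcases Finset.mem_insert.1 hu with h | h
      · exact Or.inl h
      · exact Or.inr ((mem_roots hf).1 (Multiset.mem_toFinset.1 h))
    obtain ⟨z, ⟨hxz, hzy⟩, hz⟩ := exists_root_step f hβ hxy h0 (hmem x hx) (hmem y hy)
    exact ⟨z, Multiset.mem_toFinset.2 ((mem_roots hg).2 hz), hxz, hzy⟩
  have h0s : (0 : ℝ) ∈ s := Finset.mem_insert_self _ _
  have hsR : s.erase 0 = R.erase 0 := Finset.erase_insert_eq_erase _ _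
  have hcardR : (R.erase 0).card ≤ (t \ s).card := by
    have h1 := Finset.card_erase_add_one h0s
    rw [hsR] at h1
    omega
  -- multiplicities
  have hμ : ∀ x ∈ R.erase 0, 1 ≤ f.rootMultiplicity x := by
    intro x hx
    have hx' := Multiset.mem_toFinset.1 (Finset.mem_of_mem_erase hx)
    exact (rootMultiplicity_pos hf).2 ((mem_roots hf).1 hx')
  have hμg : ∀ x ∈ t \ s, 1 ≤ g.rootMultiplicity x := by
    intro x hx
    have hx' := Multiset.mem_toFinset.1 (Finset.mem_sdiff.1 hx).1
    exact (rootMultiplicity_pos hg).2 ((mem_roots hg).1 hx')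
  have hdisj : Disjoint (R.erase 0) (t \ s) := by
    rw [Finset.disjoint_left]
    intro x hx hx'
    have hxR : x ∈ R := Finset.mem_of_mem_erase hx
    exact (Finset.mem_sdiff.1 hx').2 (Finset.mem_insert_of_mem hxR)
  have h0U : (0 : ℝ) ∉ R.erase 0 ∪ (t \ s) := by
    intro h
    rcases Finset.mem_union.1 h with h | h
    · exact (Finset.mem_erase.1 h).1 rfl
    · exact (Finset.mem_sdiff.1 h).2 h0s
  set U := insert (0 : ℝ) (R.erase 0 ∪ (t \ s)) with hU
  calc Multiset.card f.roots
      = ∑ x ∈ R, f.roots.count x := (Multiset.toFinset_sum_count_eq _).symm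
    _ ≤ ∑ x ∈ s, f.roots.count x := Finset.sum_le_sum_of_subset (Finset.subset_insert _ _)
    _ = f.roots.count 0 + ∑ x ∈ R.erase 0, f.roots.count x := by
        rw [← hsR]; exact (Finset.add_sum_erase _ _ h0s).symm
    _ = f.rootMultiplicity 0 + ∑ x ∈ R.erase 0, (f.rootMultiplicity x - 1 + 1) := by
        rw [count_roots]
        congr 1
        refine Finset.sum_congr rfl fun x hx => ?_
        rw [count_roots, Nat.sub_add_cancel (hμ x hx)]
    _ = f.rootMultiplicity 0 + ∑ x ∈ R.erase 0, (f.rootMultiplicity x - 1) + (R.erase 0).card := by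
        rw [Finset.sum_add_distrib, Finset.card_eq_sum_ones, add_assoc]
    _ ≤ g.rootMultiplicity 0 + ∑ x ∈ R.erase 0, g.rootMultiplicity x + (t \ s).card :=
        add_le_add (add_le_add (rootMultiplicity_zero_le_step hf hβ)
          (Finset.sum_le_sum fun x _ => rootMultiplicity_sub_one_le_step hf hβ x)) hcardR
    _ ≤ g.rootMultiplicity 0 + ∑ x ∈ R.erase 0, g.rootMultiplicity x
          + ∑ x ∈ t \ s, g.rootMultiplicity x := by
        rw [Finset.card_eq_sum_ones]
        exact add_le_add le_rfl (Finset.sum_le_sum fun x hx => hμg x hx)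
    _ = ∑ x ∈ U, g.rootMultiplicity x := by
        rw [hU, Finset.sum_insert h0U, Finset.sum_union hdisj, add_assoc]
    _ = ∑ x ∈ U, g.roots.count x := Finset.sum_congr rfl fun x _ => (count_roots _).symm
    _ ≤ ∑ x ∈ U ∪ t, g.roots.count x := Finset.sum_le_sum_of_subset Finset.subset_union_left
    _ = Multiset.card g.roots :=
        Multiset.sum_count_eq_card fun x hx =>
          Finset.mem_union_right _ (Multiset.mem_toFinset.2 hx)

/-- Coefficients of the `N`-fold Laguerre step: `(k + β)^N f_k`. [folklore] -/
theorem coeff_iterate (f : ℝ[X]) (β : ℝ) (N k : ℕ) :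
    ((fun p : ℝ[X] => X * derivative p + C β * p)^[N] f).coeff k
      = ((k : ℝ) + β) ^ N * f.coeff k := by
  induction N with
  | zero => simp
  | succ N ih =>
    rw [Function.iterate_succ_apply', coeff_step, ih, pow_succ]
    ring

/-- The `N`-fold Laguerre step preserves the degree (`β > 0`). [folklore] -/
theorem natDegree_iterate (f : ℝ[X]) {β : ℝ} (hβ : 0 < β) (N : ℕ) :
    ((fun p : ℝ[X] => X * derivative p + C β * p)^[N] f).natDegree = f.natDegree := by
  induction N with
  | zero => simp
  | succ N ih => rw [Function.iterate_succ_apply', natDegree_step _ hβ, ih]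

/-- **Laguerre's lemma, iterated.** The `N`-fold step `f ↦ X f' + β f` (`β > 0`) does not
decrease the number of real roots counted with multiplicity. [folklore] -/
theorem card_roots_le_iterate (f : ℝ[X]) {β : ℝ} (hβ : 0 < β) (N : ℕ) :
    Multiset.card f.roots
      ≤ Multiset.card ((fun p : ℝ[X] => X * derivative p + C β * p)^[N] f).roots := by
  induction N with
  | zero => simp
  | succ N ih =>
    rw [Function.iterate_succ_apply']
    exact ih.trans (card_roots_le_step _ hβ)

end Literature.Analysis.Complex.LaguerreCZDS

end
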